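/-
Copyright (c) 2026. All rights reserved.
Released under Apache 2.0 license as described in the file LICENSE.
Authors: abc-iut cell, prover seat abc-iut-f-072 (gen 12).
-/
import Mathlib.RingTheory.Discriminant
import Mathlib.RingTheory.AdjoinRoot
import Mathlib.LinearAlgebra.Matrix.Block
import HarnessLib

/-!
# The discriminant of the model algebras `A[X]/(X² − c)` and `(A[X]/(X² − c))^ι`

Classical commutative algebra (no definition, no `Prop` fact, no instance).  For a nontrivial commutative
ring `A` and `c ∈ A`, the `A`-algebra `B_c := A[X]/(X² − c)` (`AdjoinRoot (X^2 - C c)`) is free with power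
basis `1, x`; its trace form is `Tr(1) = 2`, `Tr(x) = 0`, `Tr(x²) = 2c`, so

* `discr_powerBasis_sq_sub` — `discr_A(1, x) = 4c`;
* `trace_pi_eq_sum` — on a finite product `ι → B` of free finite `A`-algebras the trace is the sum of the
  traces of the components;
* `discr_pi_basis_eq_prod` — the discriminant of the product basis (`Pi.basis`, reindexed to a product
  type) is the product of the discriminants (block-diagonal trace matrix, `Matrix.det_blockDiagonal`);
* `discr_pi_powerBasis_sq_sub` — hence `discr_A` of the product basis of `ι → B_c` is `(4c)^{#ι}`.

These are the local models of `𝓞_F / p^k 𝓞_F` at primes with ramification `(e, f) = (2, 1)`.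
[cite: NeukirchANT1999, Ch. I §2, p. 11 (`d = det(Tr(αᵢαⱼ))`)]
-/

namespace Literature.RingTheory.Trace

open Module Algebra Matrix Polynomial

/-! ## 1. The quadratic model `A[X]/(X² − c)` -/

section Quadratic

variable {A : Type*} [CommRing A] [Nontrivial A] (c : A)

omit [Nontrivial A] in
/-- `X² − c` is monic. [cite: NeukirchANT1999, Ch. I §2, p. 11] -/
theorem monic_X_sq_sub_C : (X ^ 2 - C c : A[X]).Monic := monic_X_pow_sub_C c two_ne_zero

omit [Nontrivial A] in
/-- In `A[X]/(X² − c)` the class `x` of `X` satisfies `x² = c`. [cite: NeukirchANT1999, Ch. I §2, p. 11] -/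
theorem root_sq_eq : (AdjoinRoot.root (X ^ 2 - C c : A[X])) ^ 2 = algebraMap A _ c := by
  have h := AdjoinRoot.eval₂_root (X ^ 2 - C c : A[X])
  rw [eval₂_sub, eval₂_X_pow, eval₂_C, sub_eq_zero] at h
  rw [h, AdjoinRoot.algebraMap_eq]

/-- The power basis `1, x` of `A[X]/(X² − c)` has dimension `2`. [cite: NeukirchANT1999, Ch. I §2, p. 11] -/
theorem powerBasis'_dim_eq_two : (AdjoinRoot.powerBasis' (monic_X_sq_sub_C c)).dim = 2 := by
  rw [AdjoinRoot.powerBasis'_dim, natDegree_X_pow_sub_C]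

/-- `A[X]/(X² − c)` is free of rank `2` over `A`. [cite: NeukirchANT1999, Ch. I §2, p. 11] -/
theorem finrank_adjoinRoot_sq_sub : Module.finrank A (AdjoinRoot (X ^ 2 - C c : A[X])) = 2 := by
  rw [(AdjoinRoot.powerBasis' (monic_X_sq_sub_C c)).finrank, powerBasis'_dim_eq_two]

/-- `Tr(a) = 2a` for `a ∈ A` in `A[X]/(X² − c)`. [cite: NeukirchANT1999, Ch. I §2, p. 11] -/
theorem trace_algebraMap_sq_sub (a : A) :
    Algebra.trace A (AdjoinRoot (X ^ 2 - C c : A[X])) (algebraMap A _ a) = 2 * a := by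
  haveI : Module.Free A (AdjoinRoot (X ^ 2 - C c : A[X])) := Module.Free.of_basis (AdjoinRoot.powerBasis' (monic_X_sq_sub_C c)).basis
  haveI : Module.Finite A (AdjoinRoot (X ^ 2 - C c : A[X])) := (AdjoinRoot.powerBasis' (monic_X_sq_sub_C c)).finite
  rw [Algebra.trace_algebraMap, finrank_adjoinRoot_sq_sub, nsmul_eq_mul, Nat.cast_ofNat]

/-- `Tr(x) = 0` in `A[X]/(X² − c)` (the matrix of `x` in the basis `1, x` is `[[0, c], [1, 0]]`).
[cite: NeukirchANT1999, Ch. I §2, p. 11] -/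
theorem trace_root_sq_sub :
    Algebra.trace A (AdjoinRoot (X ^ 2 - C c : A[X])) (AdjoinRoot.root (X ^ 2 - C c : A[X])) = 0 := by
  classical
  set pb := AdjoinRoot.powerBasis' (monic_X_sq_sub_C c) with hpb
  have hdim : pb.dim = 2 := powerBasis'_dim_eq_two c
  have hgen : pb.gen = AdjoinRoot.root (X ^ 2 - C c : A[X]) := AdjoinRoot.powerBasis'_gen _
  rw [Algebra.trace_eq_matrix_trace pb.basis, Matrix.trace]
  -- the diagonal entries `pb.basis.repr (x * x^i) i`
  have hdiag : ∀ i : Fin pb.dim, Algebra.leftMulMatrix pb.basis (AdjoinRoot.root (X ^ 2 - C c : A[X])) i i = 0 := by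
    intro i
    rw [Algebra.leftMulMatrix_eq_repr_mul, pb.coe_basis, hgen]
    have hi : (i : ℕ) = 0 ∨ (i : ℕ) = 1 := by have := i.2; omega
    rcases hi with hi | hi
    · -- `x * x^0 = x = x^1`: coordinate at index `0` vanishes
      have hx : AdjoinRoot.root (X ^ 2 - C c : A[X]) * AdjoinRoot.root (X ^ 2 - C c) ^ (i : ℕ)
          = pb.basis ⟨1, by omega⟩ := by
        rw [pb.coe_basis, hgen, hi, pow_zero, mul_one]; simp
      rw [hx, pb.basis.repr_self, Finsupp.single_apply, if_neg]
      intro h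
      have := congrArg Fin.val h
      simp [hi] at this
    · -- `x * x^1 = x² = c = c • x^0`: coordinate at index `1` vanishes
      have hx : AdjoinRoot.root (X ^ 2 - C c : A[X]) * AdjoinRoot.root (X ^ 2 - C c) ^ (i : ℕ)
          = c • pb.basis ⟨0, by omega⟩ := by
        rw [pb.coe_basis, hgen, hi, pow_one, ← sq, root_sq_eq, Algebra.algebraMap_eq_smul_one]
        simp
      rw [hx, map_smul, pb.basis.repr_self, Finsupp.smul_apply, Finsupp.single_apply, if_neg, smul_zero]
      intro h
      have := congrArg Fin.val h
      simp [hi] at this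
  exact Finset.sum_eq_zero fun i _ => by rw [Matrix.diag_apply, hdiag]

/-- **`discr_A(1, x) = 4c`** for the power basis of `A[X]/(X² − c)` (trace matrix `[[2, 0], [0, 2c]]`).
[cite: NeukirchANT1999, Ch. I §2, p. 11] -/
theorem discr_powerBasis_sq_sub :
    Algebra.discr A (AdjoinRoot.powerBasis' (monic_X_sq_sub_C c)).basis = 4 * c := by
  classical
  set pb := AdjoinRoot.powerBasis' (monic_X_sq_sub_C c) with hpb
  have hdim : pb.dim = 2 := powerBasis'_dim_eq_two c
  have hgen : pb.gen = AdjoinRoot.root (X ^ 2 - C c : A[X]) := AdjoinRoot.powerBasis'_gen _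
  -- reindex the power basis by `Fin 2`
  let e : Fin pb.dim ≃ Fin 2 := finCongr hdim
  have hre : Algebra.discr A pb.basis = Algebra.discr A (pb.basis ∘ e.symm) :=
    (Algebra.discr_reindex A pb.basis e).symm
  rw [hre, Algebra.discr_def]
  have h0 : (pb.basis ∘ e.symm) 0 = 1 := by
    simp [pb.coe_basis, e, finCongr]
  have h1 : (pb.basis ∘ e.symm) 1 = AdjoinRoot.root (X ^ 2 - C c : A[X]) := by
    simp [pb.coe_basis, e, finCongr, hgen]
  have hM : Algebra.traceMatrix A (pb.basis ∘ e.symm) = !![2, 0; 0, 2 * c] := by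
    ext i j
    rw [Algebra.traceMatrix_apply, Algebra.traceForm_apply]
    fin_cases i <;> fin_cases j
    · simp only [Fin.zero_eta, Fin.isValue, of_apply, cons_val', cons_val_zero, cons_val_fin_one]
      rw [h0, mul_one, ← (algebraMap A _).map_one, trace_algebraMap_sq_sub, mul_one]
    · simp only [Fin.zero_eta, Fin.isValue, Fin.mk_one, of_apply, cons_val', cons_val_one, cons_val_zero,
        cons_val_fin_one]
      rw [h0, h1, one_mul, trace_root_sq_sub]
    · simp only [Fin.mk_one, Fin.isValue, Fin.zero_eta, of_apply, cons_val', cons_val_zero, cons_val_one,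
        cons_val_fin_one]
      rw [h0, h1, mul_one, trace_root_sq_sub]
    · simp only [Fin.mk_one, Fin.isValue, of_apply, cons_val', cons_val_one, cons_val_fin_one]
      rw [h1, ← sq, root_sq_eq, trace_algebraMap_sq_sub]
  rw [hM, Matrix.det_fin_two_of]
  ring

end Quadratic

/-! ## 2. Finite products of free algebras: trace and discriminant -/

section Pi

variable {A : Type*} [CommRing A] {ι : Type*} [Fintype ι] [DecidableEq ι]
  {B : Type*} [CommRing B] [Algebra A B] {κ : Type*} [Fintype κ] [DecidableEq κ]

/-- On `ι → B` the algebra trace is the sum of the traces of the components (computed in the product basis).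
[cite: NeukirchANT1999, Ch. I §2, p. 11] -/
theorem trace_pi_eq_sum (b : Basis κ A B) (x : ι → B) :
    Algebra.trace A (ι → B) x = ∑ i, Algebra.trace A B (x i) := by
  classical
  rw [Algebra.trace_eq_matrix_trace (Pi.basis fun _ : ι => b), Matrix.trace]
  simp_rw [Algebra.trace_eq_matrix_trace b, Matrix.trace, Matrix.diag_apply]
  rw [← Finset.univ_sigma_univ, Finset.sum_sigma]
  refine Finset.sum_congr rfl fun i _ => Finset.sum_congr rfl fun k _ => ?_
  rw [Algebra.leftMulMatrix_eq_repr_mul, Algebra.leftMulMatrix_eq_repr_mul, Pi.basis_apply, Pi.basis_repr,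
    Pi.mul_apply, Pi.single_eq_same]

/-- The trace of `Pi.single i y` on `ι → B` is the trace of `y`. [cite: NeukirchANT1999, Ch. I §2, p. 11] -/
theorem trace_pi_single (b : Basis κ A B) (i : ι) (y : B) :
    Algebra.trace A (ι → B) (Pi.single i y) = Algebra.trace A B y := by
  rw [trace_pi_eq_sum b, Finset.sum_eq_single i (fun j _ hj => by rw [Pi.single_eq_of_ne hj, map_zero])
    (fun h => absurd (Finset.mem_univ i) h), Pi.single_eq_same]

/-- The trace matrix of the product basis of `ι → B` (indexed by `κ × ι`) is block diagonal with blocks the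
trace matrix of `b`. [cite: NeukirchANT1999, Ch. I §2, p. 11] -/
theorem traceMatrix_pi_basis (b : Basis κ A B) :
    Algebra.traceMatrix A ((Pi.basis fun _ : ι => b).reindex ((Equiv.sigmaEquivProd ι κ).trans (Equiv.prodComm ι κ)))
      = Matrix.blockDiagonal fun _ : ι => Algebra.traceMatrix A b := by
  ext ⟨k, i⟩ ⟨l, j⟩
  rw [Algebra.traceMatrix_apply, Algebra.traceForm_apply, Matrix.blockDiagonal_apply, Basis.reindex_apply,
    Basis.reindex_apply]
  simp only [Equiv.symm_trans_apply, Equiv.prodComm_symm, Equiv.prodComm_apply, Prod.swap_prod_mk,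
    Equiv.sigmaEquivProd_symm_apply, Pi.basis_apply]
  by_cases hij : i = j
  · subst hij
    rw [if_pos rfl, ← Pi.single_mul, trace_pi_single b, Algebra.traceMatrix_apply, Algebra.traceForm_apply]
  · rw [if_neg hij]
    have h0 : (Pi.single i (b k) : ι → B) * Pi.single j (b l) = 0 := by
      ext m
      rw [Pi.mul_apply, Pi.zero_apply]
      by_cases hm : m = i
      · subst hm; rw [Pi.single_eq_of_ne hij, mul_zero]
      · rw [Pi.single_eq_of_ne hm, zero_mul]
    rw [h0, map_zero]

/-- **The discriminant of the product basis of `ι → B` is `(discr_A b)^{#ι}`.**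
[cite: NeukirchANT1999, Ch. I §2, p. 11] -/
theorem discr_pi_basis_eq_prod (b : Basis κ A B) :
    Algebra.discr A ((Pi.basis fun _ : ι => b).reindex ((Equiv.sigmaEquivProd ι κ).trans (Equiv.prodComm ι κ)))
      = Algebra.discr A b ^ Fintype.card ι := by
  rw [Algebra.discr_def, traceMatrix_pi_basis b, Matrix.det_blockDiagonal, Finset.prod_const, Finset.card_univ,
    Algebra.discr_def]

end Pi

/-! ## 3. The model `(A[X]/(X² − c))^ι` -/

section Model

variable {A : Type*} [CommRing A] [Nontrivial A] (c : A) (ι : Type*) [Fintype ι] [DecidableEq ι]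

/-- **`discr_A = (4c)^{#ι}`** for the product power basis of `ι → A[X]/(X² − c)`.
[cite: NeukirchANT1999, Ch. I §2, p. 11] -/
theorem discr_pi_powerBasis_sq_sub :
    Algebra.discr A ((Pi.basis fun _ : ι => (AdjoinRoot.powerBasis' (monic_X_sq_sub_C c)).basis).reindex
        ((Equiv.sigmaEquivProd ι _).trans (Equiv.prodComm ι _)))
      = (4 * c) ^ Fintype.card ι := by
  classical
  rw [discr_pi_basis_eq_prod, discr_powerBasis_sq_sub]

/-- The product model `ι → A[X]/(X² − c)` has an `A`-basis with `2·#ι` elements and discriminant `(4c)^{#ι}`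
(existential packaging for consumers). [cite: NeukirchANT1999, Ch. I §2, p. 11] -/
theorem exists_basis_pi_sq_sub_discr :
    ∃ β : Basis (Fin 2 × ι) A (ι → AdjoinRoot (X ^ 2 - C c : A[X])),
      Algebra.discr A β = (4 * c) ^ Fintype.card ι := by
  classical
  let pb := AdjoinRoot.powerBasis' (monic_X_sq_sub_C c)
  have hdim : pb.dim = 2 := powerBasis'_dim_eq_two c
  let β₀ := (Pi.basis fun _ : ι => pb.basis).reindex ((Equiv.sigmaEquivProd ι _).trans (Equiv.prodComm ι _))
  let e : Fin pb.dim × ι ≃ Fin 2 × ι := Equiv.prodCongr (finCongr hdim) (Equiv.refl ι)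
  refine ⟨β₀.reindex e, ?_⟩
  have h := Algebra.discr_reindex A β₀ e
  rw [Basis.coe_reindex, h]
  exact discr_pi_powerBasis_sq_sub c ι

end Model

end Literature.RingTheory.Trace
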